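import Mathlib
import Summits.Ventures.PercRepro2.SwOutMixedPiecesFace

/-!
# The m-piece big-block lemma on the face `f = ⊥` (blind cell PercRepro2, night-4 g20,
2026-08-27; proofs/NIGHT4-G20.md §2)

**Theorem** `face_empty_card_le`: for every lower set `Q` with `G5` lying on the face `f = ⊥` and
every up-set `𝓔`, the non-leaking part of `Q` satisfies the rigid counting inequality with the
blue sets taken relative to the face (`EBT ∅`).

The proof.  The non-leaking points of the face are the core cube and the slab cube
(`SwOutMixedPiecesFace`), meeting in the antipodal pair `z`, `z̄` of the slab cube.  Piece A
(`SA Q`) is the core points of `Q`, with `z` removed when `z ∈ Q` and `z̄ ∉ Q`; piece B (`SB Q`)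
is everything else.  Both pieces are lower sets of their cubes (`isLowerSet_image_projA`,
`isLowerSet_image_projB`) unless BOTH `z` and `z̄` lie in `Q` — then piece B is the slab cube's
lower set `STB Q` minus the antipodal pair, whose red and blue hits cancel (`card_pair_filter`).
The cube principle (`card_le_of_embed`) applies to each piece and the counts add (`card_split`).
-/

namespace Summit.Ventures.PercRepro2

namespace MixedPieces

open scoped Classical

variable {ι μ κ : Type*} [Fintype ι] [DecidableEq ι] [Fintype μ] [DecidableEq μ] [Fintype κ]
  [DecidableEq κ]

section Pieces

variable (Q : Set (PtM ι μ κ))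

/-- Piece A: the core points of `Q`, `z` removed when `z ∈ Q` and `z̄ ∉ Q`. -/
noncomputable def SA : Finset (PtM ι μ κ) :=
  Finset.univ.filter fun p => p ∈ Q ∧ Core p ∧ ¬ (p = zPt ∧ zbPt ∉ Q)

/-- Piece B: the remaining non-leaking points of `Q`. -/
noncomputable def SB : Finset (PtM ι μ κ) :=
  Finset.univ.filter fun p => p ∈ Q ∧ ¬ Leak p ∧ (¬ Core p ∨ (p = zPt ∧ zbPt ∉ Q))

/-- The slab points of `Q` (the slab cube's lower set). -/
noncomputable def STB : Finset (PtM ι μ κ) := Finset.univ.filter fun p => p ∈ Q ∧ (TSlab p ∨ BSlab p)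

variable {Q}

/-- Membership in piece A. -/
lemma mem_SA {p : PtM ι μ κ} : p ∈ SA Q ↔ p ∈ Q ∧ Core p ∧ ¬ (p = zPt ∧ zbPt ∉ Q) := by
  simp only [SA, Finset.mem_filter, Finset.mem_univ, true_and]

/-- Membership in piece B. -/
lemma mem_SB {p : PtM ι μ κ} :
    p ∈ SB Q ↔ p ∈ Q ∧ ¬ Leak p ∧ (¬ Core p ∨ (p = zPt ∧ zbPt ∉ Q)) := by
  simp only [SB, Finset.mem_filter, Finset.mem_univ, true_and]

/-- Membership in the slab piece. -/
lemma mem_STB {p : PtM ι μ κ} : p ∈ STB Q ↔ p ∈ Q ∧ (TSlab p ∨ BSlab p) := by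
  simp only [STB, Finset.mem_filter, Finset.mem_univ, true_and]

/-- A count over the non-leaking points of `Q` splits into the two pieces. -/
lemma card_split (R : PtM ι μ κ → Prop) :
    (Finset.univ.filter fun p => p ∈ Q ∧ ¬ Leak p ∧ R p).card =
      ((SA Q).filter R).card + ((SB Q).filter R).card := by
  rw [← Finset.card_union_of_disjoint]
  · congr 1
    ext p
    simp only [Finset.mem_filter, Finset.mem_univ, true_and, Finset.mem_union, mem_SA, mem_SB]
    constructor
    · rintro ⟨hQ, hL, hR⟩
      by_cases hc : Core p
      · by_cases hz : p = zPt ∧ zbPt ∉ Q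
        · exact Or.inr ⟨⟨hQ, hL, Or.inr hz⟩, hR⟩
        · exact Or.inl ⟨⟨hQ, hc, hz⟩, hR⟩
      · exact Or.inr ⟨⟨hQ, hL, Or.inl hc⟩, hR⟩
    · rintro (⟨⟨hQ, hc, -⟩, hR⟩ | ⟨⟨hQ, hL, -⟩, hR⟩)
      · exact ⟨hQ, (not_leak_iff p).2 (Or.inl hc), hR⟩
      · exact ⟨hQ, hL, hR⟩
  · rw [Finset.disjoint_left]
    intro p hp hp'
    rw [Finset.mem_filter, mem_SA] at hp
    rw [Finset.mem_filter, mem_SB] at hp'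
    rcases hp'.1.2.2 with h | h
    · exact h hp.1.2.1
    · exact hp.1.2.2 h

/-- A point of piece B is a slab point. -/
lemma slab_of_mem_SB {p : PtM ι μ κ} (hp : p ∈ SB Q) : TSlab p ∨ BSlab p := by
  rw [mem_SB] at hp
  rcases hp.2.2 with h | ⟨h, -⟩
  · rcases (not_leak_iff p).1 hp.2.1 with hc | hs
    · exact absurd hc h
    · exact hs
  · rw [h]
    exact Or.inl tslab_zPt

end Pieces

section PieceA

variable {Q : Set (PtM ι μ κ)}

/-- The core projection is injective on piece A. -/
lemma injOn_projA (hf : Q ⊆ face ∅) : Set.InjOn projA (SA Q : Set (PtM ι μ κ)) := by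
  intro p hp q hq h
  rw [Finset.mem_coe, mem_SA] at hp hq
  rw [← coreM_projA hp.2.1 (hf hp.1), ← coreM_projA hq.2.1 (hf hq.1), h]

/-- The red set of a point of piece A is read off the core cube. -/
lemma ER_eq_coreM_projA (hf : Q ⊆ face ∅) {p : PtM ι μ κ} (hp : p ∈ SA Q) :
    ER p = ER (coreM (projA p)) := by
  rw [mem_SA] at hp
  rw [coreM_projA hp.2.1 (hf hp.1)]

/-- The relative blue set of a point of piece A is read off the flipped core cube. -/
lemma EBT_eq_coreM_projA_of_mem (hf : Q ⊆ face ∅) {p : PtM ι μ κ} (hp : p ∈ SA Q) :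
    EBT ∅ p = ER (coreM (flipAll (projA p))) := by
  rw [mem_SA] at hp
  exact EBT_eq_coreM_projA (hf hp.1) hp.2.1

/-- Piece A is a lower set of the core cube. -/
lemma isLowerSet_image_projA (hQ : IsLowerSet Q) (hG : G5 Q) (hf : Q ⊆ face ∅) :
    IsLowerSet (projA '' (SA Q : Set (PtM ι μ κ))) := by
  rintro x' x hle ⟨p', hp', rfl⟩
  rw [Finset.mem_coe, mem_SA] at hp'
  have hp'eq := coreM_projA hp'.2.1 (hf hp'.1)
  refine ⟨coreM x, ?_, projA_coreM x⟩
  rw [Finset.mem_coe, mem_SA]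
  have hxQ : (coreM x : PtM ι μ κ) ∈ Q := by
    rw [← hp'eq] at hp'
    exact hQ (coreM_mono hle) hp'.1
  refine ⟨hxQ, core_coreM x, ?_⟩
  rintro ⟨hz, hzb⟩
  -- `coreM x = z`: `x = (⊤, 0)`, so `p'` has all u-arms red; `p' = z` or `p' = F(⊤, 1)`.
  have hx : x = projA (zPt : PtM ι μ κ) := by rw [← hz, projA_coreM]
  have hs : ∀ j, p'.1 j = true := fun j => by
    have := hle (Sum.inl j)
    rw [hx] at this
    exact true_le_imp this rfl
  have hs' : p'.1 = fun _ => true := (eq_const_true_iff _).1 hs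
  have hp'form : p' = coreM (projA p') := hp'eq.symm
  cases hc : p'.2.2.1
  · -- `p' = z`
    apply hp'.2.2
    refine ⟨?_, hzb⟩
    rw [hp'form]
    simp only [coreM, projA, Sum.elim_inl, Sum.elim_inr, hs', hc, zPt]
  · -- `p' = F(⊤, 1)`, hence `z̄ ∈ Q`
    apply hzb
    apply zbPt_mem_of_top_mem hQ hG
    have : p' = ((fun _ => true), (fun _ => true), true, true, fun _ => false) := by
      rw [hp'form]
      simp only [coreM, projA, Sum.elim_inl, Sum.elim_inr, hs', hc]
    rw [← this]
    exact hp'.1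

end PieceA

section PieceB

variable {Q : Set (PtM ι μ κ)}

/-- The slab projection is injective on piece B. -/
lemma injOn_projB (hf : Q ⊆ face ∅) : Set.InjOn projB (SB Q : Set (PtM ι μ κ)) := by
  intro p hp q hq h
  rw [Finset.mem_coe] at hp hq
  rw [← tbM_projB (slab_of_mem_SB hp) (hf (mem_SB.1 hp).1),
    ← tbM_projB (slab_of_mem_SB hq) (hf (mem_SB.1 hq).1), h]

/-- The slab projection is injective on the slab piece. -/
lemma injOn_projB_STB (hf : Q ⊆ face ∅) : Set.InjOn projB (STB Q : Set (PtM ι μ κ)) := by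
  intro p hp q hq h
  rw [Finset.mem_coe, mem_STB] at hp hq
  rw [← tbM_projB hp.2 (hf hp.1), ← tbM_projB hq.2 (hf hq.1), h]

/-- The slab piece is a lower set of the slab cube. -/
lemma isLowerSet_image_projB_STB (hQ : IsLowerSet Q) (hG : G5 Q) (hf : Q ⊆ face ∅) :
    IsLowerSet (projB '' (STB Q : Set (PtM ι μ κ))) := by
  rintro y' y hle ⟨p', hp', rfl⟩
  rw [Finset.mem_coe, mem_STB] at hp'
  have hp'eq := tbM_projB hp'.2 (hf hp'.1)
  refine ⟨tbM y, ?_, projB_tbM y⟩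
  rw [Finset.mem_coe, mem_STB]
  refine ⟨tbM_mem_of_le hQ hG hle (by rw [hp'eq]; exact hp'.1), slab_tbM y⟩

/-- Piece B is a lower set of the slab cube unless both `z` and `z̄` lie in `Q`. -/
lemma isLowerSet_image_projB (hQ : IsLowerSet Q) (hG : G5 Q) (hf : Q ⊆ face ∅)
    (hne : (zbPt : PtM ι μ κ) ∉ Q ∨ (zPt : PtM ι μ κ) ∉ Q) :
    IsLowerSet (projB '' (SB Q : Set (PtM ι μ κ))) := by
  rintro y' y hle ⟨p', hp', rfl⟩
  have hp'slab := slab_of_mem_SB hp'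
  rw [Finset.mem_coe, mem_SB] at hp'
  have hp'eq := tbM_projB hp'slab (hf hp'.1)
  have hyQ : (tbM y : PtM ι μ κ) ∈ Q := tbM_mem_of_le hQ hG hle (by rw [hp'eq]; exact hp'.1)
  refine ⟨tbM y, ?_, projB_tbM y⟩
  rw [Finset.mem_coe, mem_SB]
  refine ⟨hyQ, not_leak_tbM y, ?_⟩
  by_cases hc : Core (tbM y : PtM ι μ κ)
  · right
    rcases slab_tbM (ι := ι) (κ := κ) y with hs | hs
    · -- `tbM y = z`, and `z ∈ Q`, so `z̄ ∉ Q` by `hne`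
      have hz := eq_zPt_of_core_tslab hc hs (tbM_mem_face y)
      refine ⟨hz, ?_⟩
      rw [hz] at hyQ
      rcases hne with h | h
      · exact h
      · exact absurd hyQ h
    · -- `tbM y = z̄ ∈ Q`, so `z ∉ Q`; but `p'` is `z̄` (not in piece B) or `T(⊤, 1)` (forces `z`)
      exfalso
      have hzb := eq_zbPt_of_core_bslab hc hs (tbM_mem_face y)
      rw [hzb] at hyQ
      have hz : (zPt : PtM ι μ κ) ∉ Q := by
        rcases hne with h | h
        · exact absurd hyQ h
        · exact h
      have hy : y = projB (zbPt : PtM ι μ κ) := by rw [← hzb, projB_tbM]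
      have ha : ∀ i, p'.2.1 i = true := fun i => by
        have := hle (Sum.inr (Sum.inl i))
        rw [hy] at this
        exact true_le_imp this rfl
      have he : p'.2.2.2.1 = true := by
        have := hle (Sum.inr (Sum.inr ()))
        rw [hy] at this
        exact true_le_imp this rfl
      have hff : p'.2.2.2.2 = fun _ => false := funext fun k => hf hp'.1 k (Finset.notMem_empty k)
      rcases hp'slab with ⟨hs', hu'⟩ | ⟨hs', hu'⟩
      · -- `p' = T(⊤, 1)`, which forces `z ∈ Q`
        apply hz
        apply zPt_mem_of_tslab_top_mem hQ
        have : p' = ((fun _ => true), (fun _ => true), false, true, fun _ => false) :=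
          Prod.ext hs' (Prod.ext (funext ha) (Prod.ext hu' (Prod.ext he hff)))
        rw [← this]
        exact hp'.1
      · -- `p' = z̄`, which is a core point and not `z`
        have : p' = zbPt :=
          Prod.ext hs' (Prod.ext (funext ha) (Prod.ext hu' (Prod.ext he hff)))
        rcases hp'.2.2 with h | ⟨h, -⟩
        · exact h (this ▸ core_zbPt)
        · exact zPt_ne_zbPt (h.symm.trans this)
  · exact Or.inl hc

end PieceB

section BaseCase

variable {Q : Set (PtM ι μ κ)}

/-- When both `z` and `z̄` lie in `Q`, the slab piece is piece B plus the antipodal pair. -/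
lemma STB_filter_eq (hz : (zPt : PtM ι μ κ) ∈ Q) (hzb : (zbPt : PtM ι μ κ) ∈ Q)
    (hf : Q ⊆ face ∅) (R : PtM ι μ κ → Prop) :
    (STB Q).filter R = (SB Q).filter R ∪ ({zPt, zbPt} : Finset (PtM ι μ κ)).filter R := by
  ext p
  simp only [Finset.mem_filter, Finset.mem_union, mem_STB, mem_SB, Finset.mem_insert,
    Finset.mem_singleton]
  constructor
  · rintro ⟨⟨hQ, hs⟩, hR⟩
    by_cases hc : Core p
    · right
      refine ⟨?_, hR⟩
      rcases hs with ht | hb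
      · exact Or.inl (eq_zPt_of_core_tslab hc ht (hf hQ))
      · exact Or.inr (eq_zbPt_of_core_bslab hc hb (hf hQ))
    · left
      exact ⟨⟨hQ, (not_leak_iff p).2 (Or.inr hs), Or.inl hc⟩, hR⟩
  · rintro (⟨⟨hQ, hL, hc⟩, hR⟩ | ⟨hp, hR⟩)
    · refine ⟨⟨hQ, ?_⟩, hR⟩
      rcases hc with hc | ⟨hpz, -⟩
      · rcases (not_leak_iff p).1 hL with h | h
        · exact absurd h hc
        · exact h
      · rw [hpz]
        exact Or.inl tslab_zPt
    · rcases hp with rfl | rfl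
      · exact ⟨⟨hz, Or.inl tslab_zPt⟩, hR⟩
      · exact ⟨⟨hzb, Or.inr bslab_zbPt⟩, hR⟩

/-- When `z̄ ∈ Q`, piece B avoids the antipodal pair. -/
lemma disjoint_SB_pair (hzb : (zbPt : PtM ι μ κ) ∈ Q) (R : PtM ι μ κ → Prop) :
    Disjoint ((SB Q).filter R) (({zPt, zbPt} : Finset (PtM ι μ κ)).filter R) := by
  rw [Finset.disjoint_left]
  intro p hp hp'
  rw [Finset.mem_filter, mem_SB] at hp
  rw [Finset.mem_filter, Finset.mem_insert, Finset.mem_singleton] at hp'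
  have hc : Core p := by
    rcases hp'.1 with rfl | rfl
    · exact core_zPt
    · exact core_zbPt
  rcases hp.1.2.2 with h | ⟨-, h⟩
  · exact h hc
  · exact h hzb

omit [DecidableEq ι] [DecidableEq μ] [DecidableEq κ] in
/-- The count of a predicate over the antipodal pair. -/
lemma card_pair_filter (R : PtM ι μ κ → Prop) :
    (({zPt, zbPt} : Finset (PtM ι μ κ)).filter R).card =
      (if R zPt then 1 else 0) + (if R zbPt then 1 else 0) := by
  rw [Finset.filter_insert, Finset.filter_singleton]
  by_cases h1 : R zPt <;> by_cases h2 : R zbPt <;>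
    simp [h1, h2, Finset.card_pair zPt_ne_zbPt]

omit [DecidableEq ι] [DecidableEq μ] in
/-- The red and blue hits of the antipodal pair agree (the partial flip exchanges `z`, `z̄`). -/
lemma card_pair_ER_eq_EBT {𝓔 : Set (Set (AtomM ι μ κ))} :
    (({zPt, zbPt} : Finset (PtM ι μ κ)).filter fun p => ER p ∈ 𝓔).card =
      (({zPt, zbPt} : Finset (PtM ι μ κ)).filter fun p => EBT ∅ p ∈ 𝓔).card := by
  rw [card_pair_filter, card_pair_filter]
  simp only [EBT, flipT_empty_zPt, flipT_empty_zbPt]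
  rw [add_comm]

/-- **The m-piece big-block lemma on the face `f = ⊥`**: for every lower set `Q` with `G5` on the
face and every up-set `𝓔`, the non-leaking part of `Q` satisfies the rigid counting inequality
with the blue sets relative to the face. -/
theorem face_empty_card_le (hQ : IsLowerSet Q) (hG : G5 Q) (hf : Q ⊆ face ∅)
    {𝓔 : Set (Set (AtomM ι μ κ))} (h𝓔 : IsUpperSet 𝓔) :
    (Finset.univ.filter fun p : PtM ι μ κ => p ∈ Q ∧ ¬ Leak p ∧ ER p ∈ 𝓔).card ≤
      (Finset.univ.filter fun p : PtM ι μ κ => p ∈ Q ∧ ¬ Leak p ∧ EBT ∅ p ∈ 𝓔).card := by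
  have e1 := card_split (Q := Q) (fun p => ER p ∈ 𝓔)
  have e2 := card_split (Q := Q) (fun p => EBT ∅ p ∈ 𝓔)
  beta_reduce at e1 e2
  rw [e1, e2]
  have hA : ((SA Q).filter fun p => ER p ∈ 𝓔).card ≤
      ((SA Q).filter fun p => EBT ∅ p ∈ 𝓔).card :=
    card_le_of_embed ER (EBT ∅) (SA Q) projA (injOn_projA hf) (fun x => ER (coreM x))
      (fun _ _ h => ER_coreM_mono h) (fun p hp => ER_eq_coreM_projA hf hp)
      (fun p hp => EBT_eq_coreM_projA_of_mem hf hp) (isLowerSet_image_projA hQ hG hf) h𝓔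
  have hB : ((SB Q).filter fun p => ER p ∈ 𝓔).card ≤
      ((SB Q).filter fun p => EBT ∅ p ∈ 𝓔).card := by
    by_cases hne : (zbPt : PtM ι μ κ) ∉ Q ∨ (zPt : PtM ι μ κ) ∉ Q
    · exact card_le_of_embed ER (EBT ∅) (SB Q) projB (injOn_projB hf) (fun y => ER (tbM y))
        (fun _ _ h => ER_tbM_mono h)
        (fun p hp => ER_eq_tbM_projB (hf (mem_SB.1 hp).1) (slab_of_mem_SB hp))
        (fun p hp => EBT_eq_tbM_projB (hf (mem_SB.1 hp).1) (slab_of_mem_SB hp))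
        (isLowerSet_image_projB hQ hG hf hne) h𝓔
    · have hzb : (zbPt : PtM ι μ κ) ∈ Q := by
        by_contra h
        exact hne (Or.inl h)
      have hz : (zPt : PtM ι μ κ) ∈ Q := by
        by_contra h
        exact hne (Or.inr h)
      have key := card_le_of_embed ER (EBT ∅) (STB Q) projB (injOn_projB_STB hf)
        (fun y => ER (tbM y)) (fun _ _ h => ER_tbM_mono h)
        (fun p hp => ER_eq_tbM_projB (hf (mem_STB.1 hp).1) (mem_STB.1 hp).2)
        (fun p hp => EBT_eq_tbM_projB (hf (mem_STB.1 hp).1) (mem_STB.1 hp).2)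
        (isLowerSet_image_projB_STB hQ hG hf) h𝓔
      rw [STB_filter_eq hz hzb hf, STB_filter_eq hz hzb hf,
        Finset.card_union_of_disjoint (disjoint_SB_pair hzb _),
        Finset.card_union_of_disjoint (disjoint_SB_pair hzb _), card_pair_ER_eq_EBT] at key
      omega
  exact add_le_add hA hB

end BaseCase

end MixedPieces

end Summit.Ventures.PercRepro2
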